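import Summits.HodgeConjecture.FermatCycles.ShiodaConditionFourfold
import HarnessLib

/-!
# Shioda's condition `(P⁴₅₁)` by kernel exhaustion

HONEST FRAMING: explicit algebraic cycles for specific Hodge classes on Fermat/Delsarte varieties;
residual open instances listed; no claim on general Hodge.

Companion of `ShiodaConditionFourfold.lean` (the sound search `checkB6` / `shiodaConditionUpTo_four_of_chunks` and `(P⁴₃₉)`), cell
`pub-hfermat`, topic path `Summits/HodgeConjecture/FermatCycles/` (new work, not literature). THEOREMS ONLY.

`51 = 3·17` is, after `39`, the next degree for which the cell's enumeration (`P4-TABLE.md`, two implementations + referee impl-10)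
finds Shioda's condition `(P⁴ₘ)` TRUE in the Proc. Japan Acad. / da Silva form while no refereed theorem gives the Hodge conjecture for
`X⁴ₘ` (`3 ∣ 51`: outside da Silva's Prop. 3.1; not prime, `≤ 21`, `p^e`, `2p^e` or `{2,3,5,7}`-smooth). This file makes the arithmetic
half of "HC(X⁴₅₁) follows from Shioda's Theorem 1 alone" a kernel theorem: `shiodaConditionUpTo_fiftyOne_four : ShiodaConditionUpTo 51 4`
— every Hodge `6`-multiset over `ℤ/51` (304 239 sorted candidate tuples with `Σ = 153`; 3 341 Hodge, of which 3 325 contain a pair and 16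
are quasi-decomposable, none needs the semi alternative — prototype `code/lit/p39/proto.py 51`) is decomposable, quasi-decomposable or
semi-decomposable. Seven chunks of first representatives, each `decide +kernel` (≈ 230 s kernel in all).

PRINT STATUS (lit seat, 2026-08-20): no REFEREED theorem covers this degree; PUBLIC PRIORITY for HC(X⁴ₘ) at every odd `m ≤ 199` belongs to the
computer-assisted preprint [Jumagulov2026OddFermatFourfolds] (arXiv:2608.18134, July 2026; Thm 1.1, census Thm 1.5), whose Appendix C row at this level
(`m = 51`: 217 Galois orbits = 216 decomposable + 1 quasi-decomposable) the cell reproduces by two independent enumerations (`code/lit/census/orbits.py`); this file is an INDEPENDENT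
certificate checked by the Lean kernel, not a first claim.

References: [Shioda1979PJA] T. Shioda, Proc. Japan Acad. 55A (1979) §1 (Pⁿₘ), §2 Thm 1; [daSilva2021HodgeFermat] Def. 2.4, Prop. 3.1.
[Jumagulov2026OddFermatFourfolds] R. Jumagulov, arXiv:2608.18134 (preprint, July 2026), Thm 1.1, Thm 1.5, Appendix C.
-/

namespace Summit.HodgeConjecture.FermatCycles.ShiodaConditionFourfold

open Multiset
open Literature.AlgebraicGeometry.HodgeTheory Literature.AlgebraicGeometry.HodgeTheory.FermatCharacter

set_option maxHeartbeats 0 in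
/-- The search at `N = 51`, first representatives `a ∈ [1, 3)` (56933 tuples). Kernel. [cite: Shioda1979PJA, §1 condition (Pⁿₘ), n = 4] -/
theorem checkB6_51_1 : checkB6 51 1 2 = true := by decide +kernel

set_option maxHeartbeats 0 in
/-- The search at `N = 51`, first representatives `a ∈ [3, 5)` (53761 tuples). Kernel. [cite: Shioda1979PJA, §1 condition (Pⁿₘ), n = 4] -/
theorem checkB6_51_3 : checkB6 51 3 2 = true := by decide +kernel

set_option maxHeartbeats 0 in
/-- The search at `N = 51`, first representatives `a ∈ [5, 7)` (48958 tuples). Kernel. [cite: Shioda1979PJA, §1 condition (Pⁿₘ), n = 4] -/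
theorem checkB6_51_5 : checkB6 51 5 2 = true := by decide +kernel

set_option maxHeartbeats 0 in
/-- The search at `N = 51`, first representatives `a ∈ [7, 9)` (42649 tuples). Kernel. [cite: Shioda1979PJA, §1 condition (Pⁿₘ), n = 4] -/
theorem checkB6_51_7 : checkB6 51 7 2 = true := by decide +kernel

set_option maxHeartbeats 0 in
/-- The search at `N = 51`, first representatives `a ∈ [9, 11)` (35151 tuples). Kernel. [cite: Shioda1979PJA, §1 condition (Pⁿₘ), n = 4] -/
theorem checkB6_51_9 : checkB6 51 9 2 = true := by decide +kernel

set_option maxHeartbeats 0 in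
/-- The search at `N = 51`, first representatives `a ∈ [11, 14)` (37384 tuples). Kernel. [cite: Shioda1979PJA, §1 condition (Pⁿₘ), n = 4] -/
theorem checkB6_51_11 : checkB6 51 11 3 = true := by decide +kernel

set_option maxHeartbeats 0 in
/-- The search at `N = 51`, first representatives `a ∈ [14, 51)` (29403 tuples). Kernel. [cite: Shioda1979PJA, §1 condition (Pⁿₘ), n = 4] -/
theorem checkB6_51_14 : checkB6 51 14 37 = true := by decide +kernel

/-- **`(P⁴₅₁)` holds**: every Hodge `6`-multiset over `ℤ/51` (every Hodge character of the Fermat fourfold `X⁴₅₁` up to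
permutation) is decomposable, quasi-decomposable or semi-decomposable — the arithmetic hypothesis of Shioda's Theorem 1 for `X⁴₅₁`,
a degree covered by no refereed theorem (public priority: the census of the preprint [Jumagulov2026OddFermatFourfolds,
Thm 1.5 / App. C]; this certificate is independent); certified by the cell's enumeration (P4-TABLE) and here by the kernel.
[cite: Shioda1979PJA, §1 condition (Pⁿₘ) and §2 Thm 1] -/
theorem shiodaConditionUpTo_fiftyOne_four : ShiodaConditionUpTo 51 4 :=
  shiodaConditionUpTo_four_of_chunks 51 [(1, 2), (3, 2), (5, 2), (7, 2), (9, 2), (11, 3), (14, 37)]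
    (by
      intro a ha0 ha
      rcases Nat.lt_or_ge a 3 with h1 | h1
      · exact ⟨(1, 2), by simp, by omega, by omega⟩
      rcases Nat.lt_or_ge a 5 with h2 | h2
      · exact ⟨(3, 2), by simp, h1, by omega⟩
      rcases Nat.lt_or_ge a 7 with h3 | h3
      · exact ⟨(5, 2), by simp, h2, by omega⟩
      rcases Nat.lt_or_ge a 9 with h4 | h4
      · exact ⟨(7, 2), by simp, h3, by omega⟩
      rcases Nat.lt_or_ge a 11 with h5 | h5
      · exact ⟨(9, 2), by simp, h4, by omega⟩
      rcases Nat.lt_or_ge a 14 with h6 | h6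
      · exact ⟨(11, 3), by simp, h5, by omega⟩
      · exact ⟨(14, 37), by simp, h6, by omega⟩)
    (by
      intro p hp
      simp only [List.mem_cons, List.not_mem_nil, or_false] at hp
      rcases hp with rfl | rfl | rfl | rfl | rfl | rfl | rfl
      · exact checkB6_51_1
      · exact checkB6_51_3
      · exact checkB6_51_5
      · exact checkB6_51_7
      · exact checkB6_51_9
      · exact checkB6_51_11
      · exact checkB6_51_14)

/-- Consequence in the tree's currency: every Shioda-closed family of cycle characters mod `51` contains every Hodge character of
`X⁴₅₁`. [cite: Shioda1979PJA, §2 Thm 1 and §4] -/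
theorem forall_of_isShiodaClosed_fiftyOne {C : Multiset (ZMod 51) → Prop} (hC : IsShiodaClosed C)
    (s : Multiset (ZMod 51)) (hs : IsHodgeMultiset s) (h0 : s ≠ 0) (h6 : card s ≤ 6) : C s :=
  hC.of_shiodaConditionUpTo shiodaConditionUpTo_fiftyOne_four s h0 hs h6

end Summit.HodgeConjecture.FermatCycles.ShiodaConditionFourfold
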